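import Summits.CriticalPhenomena.PercolationContinuityZ3.Theorems.PercNearOneGluingNoHeavyQuantSojourn
import Summits.CriticalPhenomena.PercolationContinuityZ3.Theorems.PercNearOneGluingNoHeavyQuantFarTreeChainStep
import HarnessLib

/-!
# QUANT lane R8: the law of the relay count on a COMB (gate coordinates) — the recursion that removes the top hair,
# and the closed form `P(N ≥ i) = Σ_k w_k p_k · PB[p, k] (i−1) + x · PB[p, K] (i−1)`

builds on p205010 (kernel theorem, internal audit signed; external expert review pending)

Support file (`--supports stmt-CriticalPhenomena-4575`), QUANT lane seat prim-quant-p1 (gen 6), rung R8 of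
`run/shared/lean/prim/quant/LADDER.md`; memo `P1-SURPLUS.md` §17.  Theorems only; no sorries; standard axioms.

Setting (gate coordinates of `Quant.FarTreeRow`, generic finite vertex type `ι`): ancestor finsets `P : ι → Finset ι` of a rooted forest
(`y ∈ P x → P y ⊆ P x`; members of `P x` pairwise comparable), independent gates `prodBernoulli q`, relay `y` reached iff `↑(P y) ⊆ ω`.
A COMB is a relay set `A ∋ a` whose other relays are enumerated `b 0, …, b (K−1)` with
`P (b k) ∩ P (b k') ⊆ P a` (`k ≠ k'`: the hairs leave `a`'s ancestral chain `P a` by pairwise disjoint private parts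
`I k = P (b k) \ P a`) and nested chain parts `D k = P (b k) ∩ P a` (`D k ⊆ D k'` for `k ≤ k'`: hairs listed root-first).
Weights: `x = ∏_{P a} q` (= `P(a reached)`), `w k = ∏_{D k} q`, `p k = ∏_{I k} q` (so `w k · p k = P(b k reached)`).

* `Quant.comb_downsets_nested` — the chain parts `P b ∩ P a` of any two vertices are `⊆`-comparable (forest axioms only).
* `Quant.comb_count_eq` — **the count law on a comb**: for `i ≥ 1`,
  `P(#{y ∈ A reached} ≥ i) = Σ_{k<K} w k · p k · PB[p, k] (i−1) + x · PB[p, K] (i−1)`, where `PB[p, k]` is the Poisson-binomial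
  recursion of `…QuantCountDP.lean` (law of the number of open private parts among the first `k` hairs).  Induction on `K` removing the
  TOP hair `b 0`: conditionally on its private part (independent of everything else), `N = N' + 1[D 0 open]` and `N' ≥ 1 ⟹ D 0 open`
  (every other relay's ancestor set contains `D 0`), so `P(N ≥ i+1) = p 0 · P(N' ≥ i) + (1 − p 0) · P(N' ≥ i+1)` (`i ≥ 1`),
  `P(N ≥ 1) = w 0 · p 0 + (1 − p 0) · P(N' ≥ 1)`; the closed form follows with the head split `PB_head`.
With `…QuantSojourn.lean` (`sojourn_weighted`) this gives FAR at every layer on combs (`…QuantFarTreeComb.lean`). [this work]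
-/

noncomputable section

namespace Summit.CriticalPhenomena.PercolationContinuityZ3.Theorems

namespace Quant

open Finset MeasureTheory
open Literature.Probability.LatticeModels
open Literature.Probability.Percolation
open scoped Classical

/-- `PB[p, m] b` = probability that exactly `b` of the first `m` independent trials succeed (recursion on `m`, as in `…QuantCountDP.lean`). -/
local notation3 "PB[" p ", " m "]" =>
  (Nat.rec (motive := fun _ => ℕ → ℝ) (fun b => if b = 0 then (1 : ℝ) else 0)
    (fun n f b => (p : ℕ → ℝ) n * (if b = 0 then (0 : ℝ) else f (b - 1)) + (1 - (p : ℕ → ℝ) n) * f b) (m : ℕ))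

variable {ι : Type*}

/-! ### Chain parts are nested -/

/-- In a rooted forest (ancestor finsets closed downwards, members of each `P x` pairwise comparable) the chain parts
`P b ∩ P a`, `P b' ∩ P a` of any two vertices are `⊆`-comparable. [this work] -/
theorem comb_downsets_nested [DecidableEq ι] (P : ι → Finset ι) (h2 : ∀ x, ∀ y ∈ P x, P y ⊆ P x)
    (h3 : ∀ x, ∀ y ∈ P x, ∀ z ∈ P x, y ∈ P z ∨ z ∈ P y) (a b b' : ι) :
    P b ∩ P a ⊆ P b' ∩ P a ∨ P b' ∩ P a ⊆ P b ∩ P a := by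
  by_contra h
  push Not at h
  obtain ⟨h1', h2'⟩ := h
  obtain ⟨y, hy, hyn⟩ := Finset.not_subset.1 h1'
  obtain ⟨z, hz, hzn⟩ := Finset.not_subset.1 h2'
  rw [Finset.mem_inter] at hy hz
  rcases h3 a y hy.2 z hz.2 with hyz | hzy
  · -- `y ∈ P z`, `z ∈ P b'` ⟹ `y ∈ P b'`
    exact hyn (Finset.mem_inter.2 ⟨h2 b' z hz.1 hyz, hy.2⟩)
  · exact hzn (Finset.mem_inter.2 ⟨h2 b y hy.1 hzy, hz.2⟩)

/-- Nested finsets: smaller-or-equal cardinality means inclusion. [folklore] -/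
theorem subset_of_nested_of_card_le {s t : Finset ι} (h : s ⊆ t ∨ t ⊆ s) (hcard : s.card ≤ t.card) : s ⊆ t := by
  rcases h with h | h
  · exact h
  · exact (Finset.eq_of_subset_of_card_le h hcard).symm.subset

/-! ### The count law on a comb -/

section Count

variable [Fintype ι] [DecidableEq ι]

omit [Fintype ι] in
/-- Counting with one relay removed: `#{y ∈ A : y reached} = #{y ∈ A ∖ b₀ : y reached} + 1[b₀ reached]`. [folklore] -/
theorem card_filter_reached_erase (P : ι → Finset ι) (A : Finset ι) {b₀ : ι} (hb₀ : b₀ ∈ A) (ω : Set ι) :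
    (A.filter fun y => ((P y : Finset ι) : Set ι) ⊆ ω).card =
      ((A.erase b₀).filter fun y => ((P y : Finset ι) : Set ι) ⊆ ω).card +
        (if ((P b₀ : Finset ι) : Set ι) ⊆ ω then 1 else 0) := by
  have hA : A = insert b₀ (A.erase b₀) := (Finset.insert_erase hb₀).symm
  conv_lhs => rw [hA]
  rw [Finset.filter_insert]
  by_cases h : ((P b₀ : Finset ι) : Set ι) ⊆ ω
  · rw [if_pos h, if_pos h, Finset.card_insert_of_notMem]
    intro hmem
    exact (Finset.notMem_erase b₀ A) (Finset.mem_filter.1 hmem).1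
  · rw [if_neg h, if_neg h, add_zero]

/-- **The count law on a comb.**  See the file header: with hairs `b 0, …, b (K−1)` listed root-first (nested chain parts, pairwise
private parts off the chain `P a`) and the sequences `p k = ∏_{P (b k) ∖ P a} q`, `w k = ∏_{P (b k) ∩ P a} q`, `x = ∏_{P a} q`, for every
`i ≥ 1`:  `P(#{y ∈ A : ↑(P y) ⊆ ω} ≥ i) = Σ_{k<K} w k · p k · PB[p, k] (i−1) + x · PB[p, K] (i−1)`. [this work] -/
theorem comb_count_eq (P : ι → Finset ι) (q : ι → unitInterval) (a : ι) (x : ℝ) (hx : x = ∏ y ∈ P a, (q y : ℝ)) :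
    ∀ (K : ℕ) (A : Finset ι) (b : ℕ → ι) (p w : ℕ → ℝ),
      a ∈ A →
      (∀ k, k < K → b k ∈ A ∧ b k ≠ a) →
      (∀ k k', k < K → k' < K → b k = b k' → k = k') →
      (∀ y ∈ A, y ≠ a → ∃ k, k < K ∧ b k = y) →
      (∀ k k', k ≤ k' → k' < K → P (b k) ∩ P a ⊆ P (b k') ∩ P a) →
      (∀ k k', k < K → k' < K → k ≠ k' → P (b k) ∩ P (b k') ⊆ P a) →
      (∀ k, p k = ∏ y ∈ P (b k) \ P a, (q y : ℝ)) →
      (∀ k, w k = ∏ y ∈ P (b k) ∩ P a, (q y : ℝ)) →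
      ∀ i, 1 ≤ i →
        (prodBernoulli q).real {ω : Set ι | i ≤ (A.filter fun y => ((P y : Finset ι) : Set ι) ⊆ ω).card} =
          ∑ k ∈ Finset.range K, w k * p k * PB[p, k] (i - 1) + x * PB[p, K] (i - 1) := by
  intro K
  induction K with
  | zero =>
    intro A b p w ha hb hinj hcover _ _ _ _ i hi
    -- `A = {a}`
    have hA : A = {a} := by
      ext y
      constructor
      · intro hy
        by_contra hne
        rw [Finset.mem_singleton] at hne
        obtain ⟨k, hk, _⟩ := hcover y hy hne
        omega
      · intro hy; rw [Finset.mem_singleton] at hy; subst hy; exact ha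
    subst hA
    rw [Finset.sum_range_zero, zero_add]
    obtain ⟨i, rfl⟩ : ∃ i', i = i' + 1 := ⟨i - 1, by omega⟩
    rw [Nat.add_sub_cancel]
    cases i with
    | zero =>
      -- `P(a reached) = x`
      rw [CountDP.PB_zero_zero, mul_one, hx, ← prodBernoulli_real_subset q (P a)]
      congr 1
      ext ω
      simp only [Set.mem_setOf_eq, zero_add]
      rw [Finset.filter_singleton]
      by_cases h : ((P a : Finset ι) : Set ι) ⊆ ω
      · simp [h]
      · simp [h]
    | succ i =>
      rw [CountDP.PB_zero_succ, mul_zero]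
      have : {ω : Set ι | i + 1 + 1 ≤ (({a} : Finset ι).filter fun y => ((P y : Finset ι) : Set ι) ⊆ ω).card} = ∅ := by
        ext ω
        simp only [Set.mem_setOf_eq, Set.mem_empty_iff_false, iff_false, not_le]
        have := Finset.card_filter_le ({a} : Finset ι) (fun y => ((P y : Finset ι) : Set ι) ⊆ ω)
        rw [Finset.card_singleton] at this
        omega
      rw [this, measureReal_empty]
  | succ K ih =>
    intro A b p w ha hb hinj hcover hmono hcomb hpdef hwdef i hi
    set μ := prodBernoulli q with hμ
    have hmeas : ∀ T : Set (Set ι), MeasurableSet T := fun T => (Set.toFinite T).measurableSet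
    -- the top hair `b 0` and the reduced comb
    have hb₀A : b 0 ∈ A := (hb 0 (by omega)).1
    have hb₀a : b 0 ≠ a := (hb 0 (by omega)).2
    set A' : Finset ι := A.erase (b 0) with hA'
    have haA' : a ∈ A' := Finset.mem_erase.2 ⟨hb₀a.symm, ha⟩
    have hb'A : ∀ k, k < K → (fun k => b (k + 1)) k ∈ A' ∧ (fun k => b (k + 1)) k ≠ a := by
      intro k hk
      refine ⟨Finset.mem_erase.2 ⟨?_, (hb (k + 1) (by omega)).1⟩, (hb (k + 1) (by omega)).2⟩
      intro h
      have := hinj (k + 1) 0 (by omega) (by omega) h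
      omega
    have hinj' : ∀ k k', k < K → k' < K → (fun k => b (k + 1)) k = (fun k => b (k + 1)) k' → k = k' := by
      intro k k' hk hk' h
      have := hinj (k + 1) (k' + 1) (by omega) (by omega) h
      omega
    have hcover' : ∀ y ∈ A', y ≠ a → ∃ k, k < K ∧ (fun k => b (k + 1)) k = y := by
      intro y hy hya
      obtain ⟨hyb, hyA⟩ := Finset.mem_erase.1 hy
      obtain ⟨k, hk, hky⟩ := hcover y hyA hya
      cases k with
      | zero => exact absurd hky.symm hyb
      | succ k => exact ⟨k, by omega, hky⟩
    have hmono' : ∀ k k', k ≤ k' → k' < K → P ((fun k => b (k + 1)) k) ∩ P a ⊆ P ((fun k => b (k + 1)) k') ∩ P a :=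
      fun k k' hkk' hk' => hmono (k + 1) (k' + 1) (by omega) (by omega)
    have hcomb' : ∀ k k', k < K → k' < K → k ≠ k' → P ((fun k => b (k + 1)) k) ∩ P ((fun k => b (k + 1)) k') ⊆ P a :=
      fun k k' hk hk' hne => hcomb (k + 1) (k' + 1) (by omega) (by omega) (by omega)
    have hpdef' : ∀ k, (fun k => p (k + 1)) k = ∏ y ∈ P ((fun k => b (k + 1)) k) \ P a, (q y : ℝ) := fun k => hpdef (k + 1)
    have hwdef' : ∀ k, (fun k => w (k + 1)) k = ∏ y ∈ P ((fun k => b (k + 1)) k) ∩ P a, (q y : ℝ) := fun k => hwdef (k + 1)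
    have IH := ih A' (fun k => b (k + 1)) (fun k => p (k + 1)) (fun k => w (k + 1)) haA' hb'A hinj' hcover' hmono' hcomb'
      hpdef' hwdef'
    have hq0 : ∀ y, (0 : ℝ) ≤ q y := fun y => (q y).2.1
    have hq1 : ∀ y, (q y : ℝ) ≤ 1 := fun y => (q y).2.2
    -- events
    set N : Set ι → ℕ := fun ω => (A.filter fun y => ((P y : Finset ι) : Set ι) ⊆ ω).card with hN
    set N' : Set ι → ℕ := fun ω => (A'.filter fun y => ((P y : Finset ι) : Set ι) ⊆ ω).card with hN'
    set J : Set (Set ι) := {ω | ((P (b 0) \ P a : Finset ι) : Set ι) ⊆ ω} with hJ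
    set ED : Set (Set ι) := {ω | ((P (b 0) ∩ P a : Finset ι) : Set ι) ⊆ ω} with hED
    -- pointwise structure
    have hPb₀ : P (b 0) = (P (b 0) ∩ P a) ∪ (P (b 0) \ P a) := by
      ext y; simp only [Finset.mem_union, Finset.mem_inter, Finset.mem_sdiff]; tauto
    have hreach₀ : ∀ ω : Set ι, ((P (b 0) : Finset ι) : Set ι) ⊆ ω ↔
        (((P (b 0) ∩ P a : Finset ι) : Set ι) ⊆ ω ∧ ((P (b 0) \ P a : Finset ι) : Set ι) ⊆ ω) := by
      intro ω
      conv_lhs => rw [hPb₀]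
      rw [Finset.coe_union, Set.union_subset_iff]
    have hNsplit : ∀ ω, N ω = N' ω + (if ((P (b 0) : Finset ι) : Set ι) ⊆ ω then 1 else 0) := fun ω =>
      card_filter_reached_erase P A hb₀A ω
    -- every other relay's ancestor set contains the chain part of the top hair
    have hD₀sub : ∀ y ∈ A', P (b 0) ∩ P a ⊆ P y := by
      intro y hy
      by_cases hya : y = a
      · subst hya; exact Finset.inter_subset_right
      · obtain ⟨k, hk, rfl⟩ := hcover' y hy hya
        exact (hmono 0 (k + 1) (by omega) (by omega)).trans Finset.inter_subset_left
    have hN'D : ∀ ω, 1 ≤ N' ω → ((P (b 0) ∩ P a : Finset ι) : Set ι) ⊆ ω := by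
      intro ω h
      obtain ⟨y, hy⟩ := Finset.card_pos.1 (by simpa [hN'] using h)
      rw [Finset.mem_filter] at hy
      exact (Finset.coe_subset.2 (hD₀sub y hy.1)).trans hy.2
    -- supports: the private part of the top hair is disjoint from everything read by `N'` and by `ED`
    set F' : Finset ι := A'.biUnion P with hF'
    have hdisj : Disjoint F' (P (b 0) \ P a) := by
      rw [hF', Finset.disjoint_biUnion_left]
      intro y hy
      rw [Finset.disjoint_left]
      intro z hzy hzI
      rw [Finset.mem_sdiff] at hzI
      by_cases hya : y = a
      · subst hya; exact hzI.2 hzy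
      · obtain ⟨k, hk, rfl⟩ := hcover' y hy hya
        have : z ∈ P (b (k + 1)) ∩ P (b 0) := Finset.mem_inter.2 ⟨hzy, hzI.1⟩
        exact hzI.2 (hcomb (k + 1) 0 (by omega) (by omega) (by omega) this)
    have hPa_sub : P a ⊆ F' := Finset.subset_biUnion_of_mem P haA'
    have dN' : ∀ Φ : ℕ → Prop, DeterminedBy {ω : Set ι | Φ (N' ω)} (↑F' : Set ι) := fun Φ =>
      determinedBy_card_filter_open A' P F' (fun y hy => Finset.subset_biUnion_of_mem P hy) Φ
    have dJ : DeterminedBy J (↑(P (b 0) \ P a) : Set ι) := determinedBy_subset_open (P (b 0) \ P a)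
    have dED : DeterminedBy ED (↑F' : Set ι) :=
      (determinedBy_subset_open (P (b 0) ∩ P a)).mono (Finset.coe_subset.2 (Finset.inter_subset_right.trans hPa_sub))
    have hPJ : μ.real J = p 0 := by rw [hJ, prodBernoulli_real_subset, hpdef 0]
    have hPEDJ : μ.real (ED ∩ J) = w 0 * p 0 := by
      rw [prodBernoulli_real_inter_of_determinedBy_disjoint q hdisj dED dJ (hmeas _) (hmeas _), hED, hJ,
        prodBernoulli_real_subset, prodBernoulli_real_subset, hwdef 0, hpdef 0]
    have hindep : ∀ Φ : ℕ → Prop, μ.real ({ω | Φ (N' ω)} ∩ J) = μ.real {ω | Φ (N' ω)} * p 0 := by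
      intro Φ
      rw [prodBernoulli_real_inter_of_determinedBy_disjoint q hdisj (dN' Φ) dJ (hmeas _) (hmeas _), hPJ]
    have hsplit : ∀ E : Set (Set ι), μ.real E = μ.real (E ∩ J) + μ.real (E \ J) := fun E =>
      (measureReal_inter_add_sdiff (μ := μ) (s := E) (hmeas _)).symm
    -- the recursion: thresholds `i+1` (`i ≥ 1`) and `1`
    have hrec : ∀ i, 1 ≤ i → μ.real {ω | i + 1 ≤ N ω} = p 0 * μ.real {ω | i ≤ N' ω} + (1 - p 0) * μ.real {ω | i + 1 ≤ N' ω} := by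
      intro i hi
      have e1 : {ω | i + 1 ≤ N ω} ∩ J = {ω | i ≤ N' ω} ∩ J := by
        ext ω
        simp only [Set.mem_inter_iff, Set.mem_setOf_eq, hJ]
        constructor
        · rintro ⟨h, hJω⟩
          refine ⟨?_, hJω⟩
          have := hNsplit ω
          split_ifs at this <;> omega
        · rintro ⟨h, hJω⟩
          refine ⟨?_, hJω⟩
          have hD := hN'D ω (by omega)
          have hreach : ((P (b 0) : Finset ι) : Set ι) ⊆ ω := (hreach₀ ω).2 ⟨hD, hJω⟩
          have := hNsplit ω
          rw [if_pos hreach] at this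
          omega
      have e2 : {ω | i + 1 ≤ N ω} \ J = {ω | i + 1 ≤ N' ω} \ J := by
        ext ω
        simp only [Set.mem_sdiff, Set.mem_setOf_eq, hJ]
        constructor
        · rintro ⟨h, hJω⟩
          refine ⟨?_, hJω⟩
          have hnr : ¬ ((P (b 0) : Finset ι) : Set ι) ⊆ ω := fun hr => hJω ((hreach₀ ω).1 hr).2
          have := hNsplit ω
          rw [if_neg hnr] at this
          omega
        · rintro ⟨h, hJω⟩
          refine ⟨?_, hJω⟩
          have := hNsplit ω
          split_ifs at this <;> omega
      have e3 : μ.real ({ω | i + 1 ≤ N' ω} \ J) = μ.real {ω | i + 1 ≤ N' ω} * (1 - p 0) := by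
        have := hsplit {ω | i + 1 ≤ N' ω}
        rw [hindep (fun n => i + 1 ≤ n)] at this
        linarith
      rw [hsplit {ω | i + 1 ≤ N ω}, e1, e2, hindep (fun n => i ≤ n), e3]
      ring
    have hrec1 : μ.real {ω | 1 ≤ N ω} = w 0 * p 0 + (1 - p 0) * μ.real {ω | 1 ≤ N' ω} := by
      have e1 : {ω | 1 ≤ N ω} ∩ J = ED ∩ J := by
        ext ω
        simp only [Set.mem_inter_iff, Set.mem_setOf_eq, hJ, hED]
        constructor
        · rintro ⟨h, hJω⟩
          refine ⟨?_, hJω⟩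
          by_cases hr : ((P (b 0) : Finset ι) : Set ι) ⊆ ω
          · exact ((hreach₀ ω).1 hr).1
          · have := hNsplit ω
            rw [if_neg hr] at this
            exact hN'D ω (by omega)
        · rintro ⟨hD, hJω⟩
          refine ⟨?_, hJω⟩
          have hreach : ((P (b 0) : Finset ι) : Set ι) ⊆ ω := (hreach₀ ω).2 ⟨hD, hJω⟩
          have := hNsplit ω
          rw [if_pos hreach] at this
          omega
      have e2 : {ω | 1 ≤ N ω} \ J = {ω | 1 ≤ N' ω} \ J := by
        ext ω
        simp only [Set.mem_sdiff, Set.mem_setOf_eq, hJ]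
        constructor
        · rintro ⟨h, hJω⟩
          refine ⟨?_, hJω⟩
          have hnr : ¬ ((P (b 0) : Finset ι) : Set ι) ⊆ ω := fun hr => hJω ((hreach₀ ω).1 hr).2
          have := hNsplit ω
          rw [if_neg hnr] at this
          omega
        · rintro ⟨h, hJω⟩
          refine ⟨?_, hJω⟩
          have := hNsplit ω
          split_ifs at this <;> omega
      have e3 : μ.real ({ω | 1 ≤ N' ω} \ J) = μ.real {ω | 1 ≤ N' ω} * (1 - p 0) := by
        have := hsplit {ω | 1 ≤ N' ω}
        rw [hindep (fun n => 1 ≤ n)] at this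
        linarith
      rw [hsplit {ω | 1 ≤ N ω}, e1, e2, hPEDJ, e3]
      ring
    -- assemble with the induction hypothesis and the head split of the recursion
    obtain ⟨i, rfl⟩ : ∃ i', i = i' + 1 := ⟨i - 1, by omega⟩
    rw [Nat.add_sub_cancel]
    cases i with
    | zero =>
      have IH1 := IH 1 le_rfl
      rw [Nat.sub_self] at IH1
      rw [hrec1, IH1, CountDP.psi_succ_one p w x K]
    | succ i =>
      have IHa := IH (i + 1) (by omega)
      have IHb := IH (i + 1 + 1) (by omega)
      rw [Nat.add_sub_cancel] at IHa IHb
      rw [hrec (i + 1) (by omega), IHa, IHb, CountDP.psi_succ_succ p w x K i]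

end Count

end Quant

end Summit.CriticalPhenomena.PercolationContinuityZ3.Theorems

end
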